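import Summits.QuantumAdvantage.QuantumAdvantage.Theorems.LinnikCubicClassGroupsDegreeOnePrimesEscapeResidueStarkLemma
import Literature.NumberTheory.LFunctions.StarkNoQuadraticSubfieldProofs
import Literature.NumberTheory.LFunctions.UniformClassGroupPNTGeneralDegreeInputs
import HarnessLib

/-!
# R: the residue bound `κ_K ≥ Q^{−10}` for number fields without quadratic subfield

Topic `Summits/QuantumAdvantage/QuantumAdvantage/Theorems`, helper for the crux `DegreeOnePrimesEscape`
(stmt-QuantumAdvantage-11543) of route `LinnikCubicClassGroups`; cell B2b-1 (linnik-cubic), PART B — the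
residue lower bound R of line `subgroup-orthogonality-escape`. HONEST FRAMING: the value of this file is a
THEOREM — not summit progress.

* `condQn_rpow_neg_ten_le_residue` — for every number field `K` of degree `≥ 2` with no quadratic subfield,
  `κ_K ≥ Q^{−10}`, `Q = |d_K|·n_K^{n_K}`: Stark's no-quadratic-subfield zero-free interval
  (`Stark1974_dedekindZeta_ne_zero_of_noQuadraticSubfield_holds`, `c = 1/(4·n!)`) in Stark's Lemma 4
  (`Residue.residue_ge_of_zeroFree`), and `e⁷ · 16ⁿ · 4 n! · log|d_K| ≤ Q³ · Q⁴ · Q² · Q = Q^{10}`;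
* `residueLowerBound_three` — the degree-`3` slice consumed by `CubicEscape.cubicEscape_of_kappaInputs`
  (`A = 10`): every cubic field has `κ_K ≥ Q^{−10}`.

## References

* H. M. Stark, *Some effective cases of the Brauer–Siegel theorem*, Invent. Math. 23 (1974)
  135–152, Lemma 4, Theorem 1'. [Stark1974]
-/

noncomputable section

open Complex Filter Topology Set NumberField NumberField.InfinitePlace
open scoped ComplexOrder

namespace Summit.QuantumAdvantage.QuantumAdvantage.Theorems.DegreeOnePrimesEscape

namespace Residue

open Literature.NumberTheory.LFunctions Literature.NumberTheory.LFunctions.NumberField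
  Literature.NumberTheory.LFunctions.Stark1974

/-! ### R: the residue bound for fields without quadratic subfield -/

/-- **R · `κ_K ≥ Q^{−10}` for every number field of degree `≥ 2` without quadratic subfield**
(`Q = |d_K| n_K^{n_K}`): Stark's no-quadratic-subfield zero-free interval
(`Stark1974_dedekindZeta_ne_zero_of_noQuadraticSubfield_holds`, `c = 1/(4·n!)`) in `residue_ge_of_zeroFree`,
and `e⁷ · 16ⁿ · 4 n! · log|d_K| ≤ Q³ · Q⁴ · Q² · Q = Q^{10}`. [cite: Stark1974, Lemma 4] -/
theorem condQn_rpow_neg_ten_le_residue (K : Type) [Field K] [NumberField K]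
    (hn : 1 < Module.finrank ℚ K) (hnq : ∀ F : IntermediateField ℚ K, Module.finrank ℚ F ≠ 2) :
    ThornerZaman.condQn K ^ (-(10 : ℝ)) ≤ dedekindZeta_residue K := by
  set n : ℕ := Module.finrank ℚ K with hndef
  set d : ℝ := ((discr K).natAbs : ℝ) with hd
  set Q : ℝ := ThornerZaman.condQn K with hQ
  have hQ12 : (12 : ℝ) ≤ Q := ThornerZaman.twelve_le_condQn (K := K) hn
  have hQ1 : (1 : ℝ) ≤ Q := by linarith
  have hd3 : (3 : ℝ) ≤ d := by
    have h2 := NumberField.abs_discr_gt_two hn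
    rw [hd, Nat.cast_natAbs]
    exact_mod_cast (show (3 : ℤ) ≤ |discr K| by omega)
  -- Stark's zero-free interval with `c = 1/(4 n!)`
  set c : ℝ := 1 / (4 * (n.factorial : ℝ)) with hc
  have hc0 : 0 < c := by rw [hc]; positivity
  have hc4 : c ≤ 1 / 4 := by
    rw [hc, div_le_div_iff₀ (by positivity) (by norm_num)]
    have : (1 : ℝ) ≤ n.factorial := by exact_mod_cast Nat.one_le_iff_ne_zero.mpr (Nat.factorial_ne_zero n)
    linarith
  have hZ : ∀ σ : ℝ, 1 - c / Real.log d ≤ σ → σ < 1 → dedekindZetaCont K σ ≠ 0 := by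
    intro σ hσ hσ1
    refine Stark1974_dedekindZeta_ne_zero_of_noQuadraticSubfield_holds K hnq σ ?_ hσ1
    rw [← hndef, ← hd]
    have : c / Real.log d = 1 / (4 * (n.factorial : ℝ) * Real.log d) := by rw [hc, div_div]
    linarith
  have hmain := residue_ge_of_zeroFree K hn hc0 hc4 hZ
  rw [← hndef] at hmain
  refine le_trans ?_ hmain
  -- `Q^{-10} ≤ e^{-7} 16^{-n} c / log d`
  have hlogd : Real.log d ≤ Q := by
    have h1 : Real.log d ≤ d := (Real.log_le_sub_one_of_pos (by linarith)).trans (by linarith)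
    have h2 : d ≤ Q := by
      rw [hQ, ThornerZaman.condQn, hd, Nat.cast_natAbs, Int.cast_abs]
      have hn1 : (1 : ℝ) ≤ (Module.finrank ℚ K : ℝ) ^ Module.finrank ℚ K := by
        have : (1 : ℝ) ≤ Module.finrank ℚ K := by exact_mod_cast Module.finrank_pos (R := ℚ) (M := K)
        exact one_le_pow₀ this
      nlinarith [abs_nonneg ((discr K : ℝ))]
    linarith
  have hlogd0 : 0 < Real.log d := Real.log_pos (by linarith)
  have hfact : (n.factorial : ℝ) ≤ Q := by
    -- `n! ≤ n^n ≤ |d_K| n^n = Q`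
    have h1 : (n.factorial : ℝ) ≤ (n : ℝ) ^ n := by exact_mod_cast Nat.factorial_le_pow n
    have h2 : (n : ℝ) ^ n ≤ Q := by
      rw [hQ, ThornerZaman.condQn, ← hndef]
      have hd1 : (1 : ℝ) ≤ |(discr K : ℝ)| := by
        rw [← Int.cast_abs]; exact_mod_cast Int.one_le_abs (discr_ne_zero K)
      have hnn : (0 : ℝ) ≤ (n : ℝ) ^ n := by positivity
      nlinarith
    linarith
  have h16 : (16 : ℝ) ^ n ≤ Q ^ 4 := by
    -- `16^n = (2^n)^4 ≤ (n^n)^4 ≤ Q^4` for `n ≥ 2`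
    have h2n : (2 : ℝ) ^ n ≤ Q := by
      have h1 : (2 : ℝ) ^ n ≤ (n : ℝ) ^ n := pow_le_pow_left₀ (by norm_num) (by exact_mod_cast hn) n
      have h2 : (n : ℝ) ^ n ≤ Q := by
        rw [hQ, ThornerZaman.condQn, ← hndef]
        have hd1 : (1 : ℝ) ≤ |(discr K : ℝ)| := by
          rw [← Int.cast_abs]; exact_mod_cast Int.one_le_abs (discr_ne_zero K)
        have hnn : (0 : ℝ) ≤ (n : ℝ) ^ n := by positivity
        nlinarith
      linarith
    calc (16 : ℝ) ^ n = (2 ^ n) ^ 4 := by rw [← pow_mul, show (16 : ℝ) = 2 ^ 4 by norm_num, ← pow_mul, mul_comm]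
      _ ≤ Q ^ 4 := pow_le_pow_left₀ (by positivity) h2n 4
  have he7 : Real.exp 7 ≤ Q ^ 3 := by
    have h1 : Real.exp 7 < 1728 := by
      have := Real.exp_one_lt_d9
      have h7 : Real.exp 7 = Real.exp 1 ^ 7 := by rw [← Real.exp_nat_mul]; norm_num
      rw [h7]
      have : Real.exp 1 ^ 7 < 2.7182818286 ^ 7 := pow_lt_pow_left₀ this (Real.exp_pos _).le (by norm_num)
      linarith [show (2.7182818286 : ℝ) ^ 7 < 1728 by norm_num]
    have h2 : (1728 : ℝ) ≤ Q ^ 3 := by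
      have := pow_le_pow_left₀ (by norm_num) hQ12 3
      norm_num at this
      exact this
    linarith
  -- assemble: `Q^{10} · (e^{-7} 16^{-n} c / log d) ≥ 1`
  have hQ0 : 0 < Q := by linarith
  have hprod : Real.exp 7 * 16 ^ n * (4 * n.factorial) * Real.log d ≤ Q ^ 10 := by
    calc Real.exp 7 * 16 ^ n * (4 * n.factorial) * Real.log d
        ≤ Q ^ 3 * Q ^ 4 * (Q * Q) * Q := by
          apply mul_le_mul (mul_le_mul (mul_le_mul he7 h16 (by positivity) (by positivity)) _
            (by positivity) (by positivity)) hlogd hlogd0.le (by positivity)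
          nlinarith
      _ = Q ^ 10 := by ring
  have hpos : 0 < Real.exp 7 * 16 ^ n * (4 * n.factorial) * Real.log d := by positivity
  have hfact0 : (n.factorial : ℝ) ≠ 0 := by positivity
  have hD : Real.exp (-7) * (1 / 16 : ℝ) ^ n * (c / Real.log d) =
      (Real.exp 7 * 16 ^ n * (4 * n.factorial) * Real.log d)⁻¹ := by
    rw [hc, Real.exp_neg]
    field_simp
    rw [← mul_pow]; norm_num
  rw [Real.rpow_neg hQ0.le, show (10 : ℝ) = ((10 : ℕ) : ℝ) by norm_num, Real.rpow_natCast, hD]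
  exact inv_anti₀ hpos hprod

/-- **R at degree `3`** (the slice consumed by `CubicEscape`): `κ_K ≥ Q^{−10}` for every cubic number
field (a cubic field has no quadratic subfield by the tower law). -/
theorem residueLowerBound_three :
    ∀ (K : Type) [Field K] [NumberField K], Module.finrank ℚ K = 3 →
      ThornerZaman.condQn K ^ (-(10 : ℝ)) ≤ NumberField.dedekindZeta_residue K := by
  intro K _ _ hK
  refine condQn_rpow_neg_ten_le_residue K (by rw [hK]; norm_num) fun F hF ↦ ?_
  have hdvd : Module.finrank ℚ F ∣ Module.finrank ℚ K := Dvd.intro _ (Module.finrank_mul_finrank ℚ F K)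
  rw [hF, hK] at hdvd
  omega

end Residue

end Summit.QuantumAdvantage.QuantumAdvantage.Theorems.DegreeOnePrimesEscape

end
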